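import Mathlib.Analysis.SpecificLimits.Basic
import Mathlib.Analysis.Normed.Group.Continuity
import HarnessLib

/-!
# T⁴ programme, node NE3 — route Π, the seat technique's kernel core: A RESIDUAL-DESCENT (NEWTON-TYPE) SCHEME CONVERGES — in a complete metric space,
# a step map that contracts the residual by `q < 1` and moves by at most `K·‖residual‖` on a closed ball containing the geometric sum has a ZERO of the
# residual in that ball

NE3 (node U1b), row NE3 OWNER `b2b-balaban-t4-ne3-p1` (gen 26; seat technique «implicit function ∕ contraction mapping»; design note
`HOME/t4/b2b-balaban-t4-ne3-p1/g26/D-ne3p1-g26-1.md` §1 stub (iv)).  The EXISTENCE campaign for the residual slice representative (leaf Π-L1♮) runs the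
Newton scheme `u ↦ e^{−mu(Z(u))}·u` on the residual gauge group; §1 of the note shows its residual `mu(Z(u_n))` contracts by a factor `q` and its step has
length `≤ K·‖mu(Z(u_n))‖` as long as the iterate stays in the ball where the BCH letters apply.  This file is the ABSTRACT convergence half, once and for
all: no derivative, no Lipschitz constant of the step map is needed (unlike the Banach∕Newton–Kantorovich forms `exists_zero_of_newton_contraction`
elsewhere in the tree) — only residual contraction and step control, which is what the gauge scheme delivers.

CONTENT ([folklore]; 0 sorry; no data): `geomSum_step` (the partial geometric sum identity∕bound); **`exists_zero_of_residual_descent`**: `G` complete metric,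
`F : G → E` continuous into a normed group, `Φ : G → G`; if on `{u : dist u u₁ ≤ δ, ‖F u‖ ≤ ‖F u₁‖}` the step satisfies `‖F (Φ u)‖ ≤ q‖F u‖` and
`dist (Φ u) u ≤ K‖F u‖` (`0 ≤ q < 1`, `0 ≤ K`), and `K‖F u₁‖∕(1−q) ≤ δ`, then `∃ u, dist u u₁ ≤ δ ∧ F u = 0` (the iterates `Φ^[n] u₁` are Cauchy by
`cauchySeq_of_le_geometric`, the limit is within `δ` by `dist_le_of_le_geometric_of_tendsto₀`, and `F` vanishes there by continuity and `‖F (Φ^[n] u₁)‖ ≤ qⁿ‖F u₁‖`);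
`iterate_invariant` (the quantitative invariants, exported for the campaign's α₀-bookkeeping), `exists_zero_of_residual_descent'` (δ = the geometric sum).

HONEST FRAMING.  Elementary complete-metric-space analysis; nothing about gauge fields; the campaign's letters (BCH, the slice projection's sup norms, the
right inverse's sup letter) are NOT here; Π-L1♮, T-E_w♯ and NE3 are NOT proved; spine PROVED 0∕9; finite T⁴ rung (B)+1 — NOT infinite volume, NOT mass gap,
NOT `BetaPertH`, NOT Clay.  PLACEMENT: `Summits/QuantumFields/BalabanUV/`.  HONEST DEPENDENCY: continuum YM on T⁴ ⇐ BetaPertH ∧ nine spine estimates (0/9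
proved); BetaPertH ⇐ (D1) ∧ (D4) ∧ CAP+tail; G-an2-4 gates asym, D1 and NE2/3/4.
-/

set_option autoImplicit false

open Filter Topology Metric

namespace Summit.QuantumFields.BalabanUV.T4Continuum.NE3ResidualDescentScheme

variable {G : Type*} [MetricSpace G] {E : Type*} [NormedAddCommGroup E]

/-- The partial geometric sum grows by `qⁿ` and stays below `1∕(1−q)`: `(1 − qⁿ)∕(1−q) + qⁿ = (1 − q^{n+1})∕(1−q)` and `(1 − qⁿ)∕(1−q) ≤ 1∕(1−q)`
(`0 ≤ q < 1`). [folklore] -/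
theorem geomSum_step {q : ℝ} (hq0 : 0 ≤ q) (hq1 : q < 1) (n : ℕ) :
    (1 - q ^ n) / (1 - q) + q ^ n = (1 - q ^ (n + 1)) / (1 - q) ∧ (1 - q ^ n) / (1 - q) ≤ 1 / (1 - q) := by
  have h1q : 0 < 1 - q := by linarith
  constructor
  · field_simp
    ring
  · exact div_le_div_of_nonneg_right (by linarith [pow_nonneg hq0 n]) h1q.le

/-- **THE INVARIANTS OF THE SCHEME**: under the step hypotheses on the ball, the `n`-th iterate has residual `≤ qⁿ·‖F u₁‖` and lies within
`K‖F u₁‖(1 − qⁿ)∕(1−q)` of the start. [folklore] -/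
theorem iterate_invariant {F : G → E} {Φ : G → G} {u₁ : G} {q K δ : ℝ} (hq0 : 0 ≤ q) (hq1 : q < 1) (hK : 0 ≤ K)
    (hδ : K * ‖F u₁‖ / (1 - q) ≤ δ)
    (hstep : ∀ u : G, dist u u₁ ≤ δ → ‖F u‖ ≤ ‖F u₁‖ → ‖F (Φ u)‖ ≤ q * ‖F u‖ ∧ dist (Φ u) u ≤ K * ‖F u‖) :
    ∀ n : ℕ, ‖F (Φ^[n] u₁)‖ ≤ q ^ n * ‖F u₁‖ ∧ dist (Φ^[n] u₁) u₁ ≤ K * ‖F u₁‖ * ((1 - q ^ n) / (1 - q)) := by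
  have h1q : 0 < 1 - q := by linarith
  have hF0 : 0 ≤ ‖F u₁‖ := norm_nonneg _
  intro n
  induction n with
  | zero => simp
  | succ n ih =>
      obtain ⟨hres, hdist⟩ := ih
      obtain ⟨e, hle⟩ := geomSum_step hq0 hq1 n
      -- the `n`-th iterate is in the region where the step hypotheses apply
      have hqn1 : q ^ n ≤ 1 := pow_le_one₀ hq0 hq1.le
      have hin : dist (Φ^[n] u₁) u₁ ≤ δ := by
        refine hdist.trans (le_trans ?_ hδ)
        have := mul_le_mul_of_nonneg_left hle (mul_nonneg hK hF0)
        exact this.trans (le_of_eq (by ring))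
      have hsmall : ‖F (Φ^[n] u₁)‖ ≤ ‖F u₁‖ := hres.trans (by nlinarith)
      obtain ⟨h1, h2⟩ := hstep _ hin hsmall
      rw [Function.iterate_succ_apply']
      refine ⟨h1.trans (by rw [pow_succ]; nlinarith), ?_⟩
      calc dist (Φ (Φ^[n] u₁)) u₁ ≤ dist (Φ (Φ^[n] u₁)) (Φ^[n] u₁) + dist (Φ^[n] u₁) u₁ := dist_triangle _ _ _
        _ ≤ K * ‖F (Φ^[n] u₁)‖ + K * ‖F u₁‖ * ((1 - q ^ n) / (1 - q)) := add_le_add h2 hdist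
        _ ≤ K * (q ^ n * ‖F u₁‖) + K * ‖F u₁‖ * ((1 - q ^ n) / (1 - q)) := by
            have := mul_le_mul_of_nonneg_left hres hK; linarith
        _ = K * ‖F u₁‖ * ((1 - q ^ n) / (1 - q) + q ^ n) := by ring
        _ = K * ‖F u₁‖ * ((1 - q ^ (n + 1)) / (1 - q)) := by rw [e]

/-- **A RESIDUAL-DESCENT SCHEME HAS A ZERO.**  `G` a complete metric space, `F : G → E` continuous, `Φ : G → G` a step map which, on the region
`dist u u₁ ≤ δ`, `‖F u‖ ≤ ‖F u₁‖`, contracts the residual (`‖F (Φ u)‖ ≤ q‖F u‖`, `0 ≤ q < 1`) and moves by at most `K‖F u‖`; if the geometric sum fits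
(`K‖F u₁‖∕(1−q) ≤ δ`) then `F` has a zero within `δ` of `u₁` — the limit of the iterates. [folklore] -/
theorem exists_zero_of_residual_descent [CompleteSpace G] {F : G → E} (hF : Continuous F) {Φ : G → G} {u₁ : G} {q K δ : ℝ}
    (hq0 : 0 ≤ q) (hq1 : q < 1) (hK : 0 ≤ K) (hδ : K * ‖F u₁‖ / (1 - q) ≤ δ)
    (hstep : ∀ u : G, dist u u₁ ≤ δ → ‖F u‖ ≤ ‖F u₁‖ → ‖F (Φ u)‖ ≤ q * ‖F u‖ ∧ dist (Φ u) u ≤ K * ‖F u‖) :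
    ∃ u : G, dist u u₁ ≤ δ ∧ F u = 0 := by
  have h1q : 0 < 1 - q := by linarith
  have hF0 : 0 ≤ ‖F u₁‖ := norm_nonneg _
  have hinv := iterate_invariant hq0 hq1 hK hδ hstep
  set v : ℕ → G := fun n => Φ^[n] u₁ with hv
  -- consecutive iterates are geometrically close
  have hgeo : ∀ n : ℕ, dist (v n) (v (n + 1)) ≤ K * ‖F u₁‖ * q ^ n := by
    intro n
    obtain ⟨hres, hdist⟩ := hinv n
    obtain ⟨-, hle⟩ := geomSum_step hq0 hq1 n
    have hin : dist (Φ^[n] u₁) u₁ ≤ δ := by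
      refine hdist.trans (le_trans ?_ hδ)
      have := mul_le_mul_of_nonneg_left hle (mul_nonneg hK hF0)
      exact this.trans (le_of_eq (by ring))
    have hqn1 : q ^ n ≤ 1 := pow_le_one₀ hq0 hq1.le
    have hsmall : ‖F (Φ^[n] u₁)‖ ≤ ‖F u₁‖ := hres.trans (by nlinarith)
    obtain ⟨-, h2⟩ := hstep _ hin hsmall
    simp only [hv, Function.iterate_succ_apply']
    rw [dist_comm]
    calc dist (Φ (Φ^[n] u₁)) (Φ^[n] u₁) ≤ K * ‖F (Φ^[n] u₁)‖ := h2
      _ ≤ K * (q ^ n * ‖F u₁‖) := mul_le_mul_of_nonneg_left hres hK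
      _ = K * ‖F u₁‖ * q ^ n := by ring
  have hcauchy : CauchySeq v := cauchySeq_of_le_geometric q (K * ‖F u₁‖) hq1 hgeo
  obtain ⟨u, hu⟩ := cauchySeq_tendsto_of_complete hcauchy
  refine ⟨u, ?_, ?_⟩
  · -- the limit is within the geometric sum of the start
    have h0 := dist_le_of_le_geometric_of_tendsto₀ q (K * ‖F u₁‖) hq1 hgeo hu
    have e0 : v 0 = u₁ := rfl
    rw [e0, dist_comm] at h0
    exact h0.trans hδ
  · -- the residual vanishes at the limit
    have hlim : Tendsto (fun n => F (v n)) atTop (𝓝 (F u)) := (hF.tendsto u).comp hu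
    have hzero : Tendsto (fun n => F (v n)) atTop (𝓝 0) := by
      refine squeeze_zero_norm (fun n => (hinv n).1) ?_
      simpa using (tendsto_pow_atTop_nhds_zero_of_lt_one hq0 hq1).mul_const ‖F u₁‖
    exact tendsto_nhds_unique hlim hzero

/-- The quantitative corollary used for the α₀-bookkeeping of the campaign: the zero is within `K‖F u₁‖∕(1−q)` of the start. [folklore] -/
theorem exists_zero_of_residual_descent' [CompleteSpace G] {F : G → E} (hF : Continuous F) {Φ : G → G} {u₁ : G} {q K : ℝ}
    (hq0 : 0 ≤ q) (hq1 : q < 1) (hK : 0 ≤ K)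
    (hstep : ∀ u : G, dist u u₁ ≤ K * ‖F u₁‖ / (1 - q) → ‖F u‖ ≤ ‖F u₁‖ → ‖F (Φ u)‖ ≤ q * ‖F u‖ ∧ dist (Φ u) u ≤ K * ‖F u‖) :
    ∃ u : G, dist u u₁ ≤ K * ‖F u₁‖ / (1 - q) ∧ F u = 0 :=
  exists_zero_of_residual_descent hF hq0 hq1 hK le_rfl hstep

end Summit.QuantumFields.BalabanUV.T4Continuum.NE3ResidualDescentScheme
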